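import Summits.QuantumFields.BalabanUV.Beta.SpineRootedW2

/-!
# The first multiplier table with a TABLE SLOT: `M1Of H cΛ j μ w := (cΛ·wM1 j) • H μ w` over ANY constraint-Hessian table `H`;
# `M1At ρ` and `M1` as its two instances (`rfl`), and the slot-generic bookkeeping (vertex family, block covariance, linearity in the table)
# (β sub-cell, row BETA-an2 = BINDER-OWNERS row D1, table-slot refactor «SLOT-M1» of ruling R-D1-g25-2 (3); seat t4-ne9-formalise-leaf-03 gen 34)

HONEST FRAMING (cell charter, verbatim): «discharging BetaPertH makes Balaban's UV stability UNCONDITIONAL — a real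
constructive-QFT result; it is NOT the continuum limit and NOT the Clay problem.»  DERIVED cell leaf (pub-balaban β sub-cell); no
statement of Bałaban's papers is typed here, no `[cite:]` tag, no `Prop` fact; it instantiates no binder of the β-function wall by
itself.  NOT D1, NOT `BetaPertH`; NOT continuum; NOT Clay.

## Why

The row-D1 owner's re-instantiation route for the literal `JsB12Sym` (ruling R-D1-g25-2 (3); an3's LETTER-AUDIT §4, row hM₂0: «`M1At`
needs a table slot») asks that every definition which HARD-WIRES a comb table get a TABLE PARAMETER in a new sibling module — pattern
`BalabanStepW2.M2Of mixFF j := (wM2 j) • mixFF` — with the landed objects recovered by `rfl`, so that the table-generic («V1») lemmas are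
literally SHARED between the frozen comb template and the symmetrised tables.  `SpineRootedW2.M1At ρ cΛ j μ w := (cΛ·wM1 j) • hessFFAt ρ Lc μ w`
hard-wires an1's ROOTED constraint Hessian `hessFFAt ρ`; `BalabanStepW2.M1` hard-wires the corner-rooted `hessFF`.  This file is the slot.

## What is here

* §1 **`M1Of d Lc H cΛ j μ w := (cΛ·wM1 d Lc j) • H μ w`** over ANY table `H : Fin (d+1) → (Fin (d+1) → ℤ) → MKer (d+1) (Fib d)`; unfolding
  lemma; **bridges by `rfl`**: `M1Of_hessFFAt : M1Of d Lc (hessFFAt ρ Lc) cΛ j = M1At d Lc ρ cΛ j`, `M1Of_hessFF : M1Of d Lc (hessFF Lc) cΛ j = M1 d Lc cΛ j`.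
* §2 slot-generic bookkeeping = the two hypotheses `W2SymOfK` consumes of its multiplier table, now over the slot: **`vertexFamily_M1Of`**
  (`VertexFamily H Lc C δ ⟹ VertexFamily (M1Of H cΛ j) Lc (|cΛ·wM1 j|·C) δ`) and **`M1Of_translate`** (block covariance of `H` ⟹ that of
  `M1Of H`) — the proofs of `vertexFamily_M1At` ∕ `M1At_translate` with an1's `biLoc_hessFFAt` ∕ `hessFFAt_translate` abstracted into binders.
* §3 LINEARITY IN THE SLOT (for tables given as sums ∕ means of conjugated tables, e.g. an `S_D`-mean): `M1Of_add`, `M1Of_smul`, `M1Of_sum`,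
  `M1Of_zero`, `M1Of_coupling_zero` (`cΛ = 0`), and the two §2 binders for a finite sum of tables (`vertexFamily_sum`, `translate_sum`).

NOT here: any `JsB12Sym` instance (the owner's ∕ an1's symmetrised Hessian table fills `H`); the slots of `SpureRecAt`∕`SrecAt`, `coDressKBmAt`,
`bhKAt` (sibling rows).  All declarations `[folklore]`; axioms standard.  Provenance: b2b-balaban β sub-cell, seat
`b2b-balaban-t4-ne9-formalise-leaf-03` gen 34 (cross-cell idle-seat kernel row), 2026-08-21 (v1); over an2's `SpineRootedW2` (gen 11) and
`BalabanStepW2` BY NAME; no existing file touched.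
-/

open Finset
open scoped BigOperators
open Literature.MathematicalPhysics.QuantumFieldTheory
open Literature.MathematicalPhysics.QuantumFieldTheory.Balaban1983to89
open Literature.MathematicalPhysics.QuantumFieldTheory.Balaban1983to89.Beta
open ExpKernelCalculus (MKer BiLoc VertexFamily shiftK)
open OneStepResolventKernel (Fib)
open AffineAveraging (box toSite)
open StepJetData (biLoc_smul)
open OneStepResolventKernel (biLoc_finset_sum)
open AveragingHessianKernels (hessFF ell)
open AveragingHessianKernelsRooted (hessFFAt biLoc_hessFFAt hessFFAt_translate)
open BalabanStepW2 (wM1 M1)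

noncomputable section

namespace Summit.QuantumFields.BalabanUV.Beta.SpineRooted

variable {d : ℕ}

/-! ## §1 The multiplier table over a table slot, and its two instances -/

section Def

variable (d) (Lc : ℕ)

/-- [folklore] **THE FIRST MULTIPLIER TABLE WITH A TABLE SLOT**: `M1Of H cΛ j μ w := (cΛ·wM1 j) • H μ w` — the weight `wM1 j` and the
colour constant `cΛ` of `BalabanStepW2.M1` ∕ `SpineRootedW2.M1At`, over an ARBITRARY constraint-Hessian table `H` (pattern `M2Of`).
Instances: `H := hessFFAt ρ Lc` (`M1At ρ`), `H := hessFF Lc` (`M1`), both by `rfl`. -/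
def M1Of (H : Fin (d + 1) → (Fin (d + 1) → ℤ) → MKer (d + 1) (Fib d)) (cΛ : ℝ) (j : ℕ) :
    Fin (d + 1) → (Fin (d + 1) → ℤ) → MKer (d + 1) (Fib d) :=
  fun μ w => (cΛ * wM1 d Lc j) • H μ w

variable {d Lc} (H : Fin (d + 1) → (Fin (d + 1) → ℤ) → MKer (d + 1) (Fib d)) (cΛ : ℝ) (j : ℕ)

/-- [folklore] Unfolding lemma: `M1Of H cΛ j μ w = (cΛ·wM1 j) • H μ w`. -/
theorem M1Of_apply (μ : Fin (d + 1)) (w : Fin (d + 1) → ℤ) : M1Of d Lc H cΛ j μ w = (cΛ * wM1 d Lc j) • H μ w := rfl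

/-- [folklore] **BRIDGE (ROOTED INSTANCE), by `rfl`:** the slot filled with an1's rooted constraint Hessian `hessFFAt ρ Lc` is
`SpineRootedW2.M1At ρ`. -/
theorem M1Of_hessFFAt (ρ : Fin (d + 1) → ℤ) : M1Of d Lc (hessFFAt ρ Lc) cΛ j = M1At d Lc ρ cΛ j := rfl

/-- [folklore] **BRIDGE (CORNER-ROOTED INSTANCE), by `rfl`:** the slot filled with `hessFF Lc` is `BalabanStepW2.M1`. -/
theorem M1Of_hessFF : M1Of d Lc (hessFF Lc) cΛ j = M1 d Lc cΛ j := rfl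

end Def

/-! ## §2 The two hypotheses `W2SymOfK` consumes of its multiplier table, over the slot -/

section Generic

variable {Lc : ℕ} {H : Fin (d + 1) → (Fin (d + 1) → ℤ) → MKer (d + 1) (Fib d)}

/-- [folklore] **`M1Of H cΛ j` IS A VERTEX FAMILY WHENEVER `H` IS** (blocking `Lc`, same rate, constant `|cΛ·wM1 j|·C`) — the proof of
`vertexFamily_M1At` ∕ `BalabanStepW2.vertexFamily_M1` with an1's `biLoc_hessFFAt` ∕ `biLoc_hessFF` abstracted into the binder `hH`. -/
theorem vertexFamily_M1Of {C δ : ℝ} (hH : VertexFamily H Lc C δ) (cΛ : ℝ) (j : ℕ) :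
    VertexFamily (M1Of d Lc H cΛ j) Lc (|cΛ * wM1 d Lc j| * C) δ :=
  fun μ w => biLoc_smul (hH μ w) (cΛ * wM1 d Lc j)

/-- [folklore] **COARSE-TRANSLATION COVARIANCE OF `M1Of H`** from that of the table (the `hM` hypothesis of `W2SymOfK_translate`):
`H μ (w + t) = shiftK (−Lc•t) (H μ w)` for all `μ w t` ⟹ `M1Of H cΛ j μ (w + t) = shiftK (−Lc•t) (M1Of H cΛ j μ w)`. -/
theorem M1Of_translate
    (hH : ∀ (μ : Fin (d + 1)) (w t : Fin (d + 1) → ℤ), H μ (w + t) = shiftK (-((Lc : ℤ) • t)) (H μ w))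
    (cΛ : ℝ) (j : ℕ) (μ : Fin (d + 1)) (w t : Fin (d + 1) → ℤ) :
    M1Of d Lc H cΛ j μ (w + t) = shiftK (-((Lc : ℤ) • t)) (M1Of d Lc H cΛ j μ w) := by
  funext x z a b
  simp only [M1Of, Pi.smul_apply, smul_eq_mul, shiftK]
  rw [hH μ w t]
  rfl

/-- [folklore] The rooted instance of §2 recovers `vertexFamily_M1At` (in-block root, any rate `δ ≥ 0`) — a consistency check BY NAME. -/
theorem vertexFamily_M1Of_hessFFAt (hLc : 1 ≤ Lc) {r : Fin (d + 1) → ℕ} (hr : r ∈ box (d + 1) Lc) (cΛ : ℝ) (j : ℕ) {δ : ℝ}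
    (hδ : 0 ≤ δ) :
    VertexFamily (M1Of d Lc (hessFFAt (toSite r) Lc) cΛ j) Lc
      (|cΛ * wM1 d Lc j| * (2 * (ell (d + 1) Lc : ℝ) ^ 2 * Real.exp (4 * ((d : ℝ) + 1) * Lc * δ))) δ :=
  vertexFamily_M1Of (fun μ w => biLoc_hessFFAt hLc μ w hr hδ) cΛ j

/-- [folklore] The rooted instance of §2 recovers `M1At_translate` (any root) — a consistency check BY NAME. -/
theorem M1Of_hessFFAt_translate (ρ : Fin (d + 1) → ℤ) (cΛ : ℝ) (j : ℕ) (μ : Fin (d + 1)) (w t : Fin (d + 1) → ℤ) :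
    M1Of d Lc (hessFFAt ρ Lc) cΛ j μ (w + t) = shiftK (-((Lc : ℤ) • t)) (M1Of d Lc (hessFFAt ρ Lc) cΛ j μ w) :=
  M1Of_translate (fun μ w t => hessFFAt_translate ρ μ w t) cΛ j μ w t

end Generic

/-! ## §3 Linearity in the slot -/

section Linear

variable {Lc : ℕ} (H H' : Fin (d + 1) → (Fin (d + 1) → ℤ) → MKer (d + 1) (Fib d)) (cΛ : ℝ) (j : ℕ)

/-- [folklore] `M1Of` is additive in the table. -/
theorem M1Of_add : M1Of d Lc (H + H') cΛ j = M1Of d Lc H cΛ j + M1Of d Lc H' cΛ j := by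
  funext μ w
  simp only [M1Of, Pi.add_apply, smul_add]

/-- [folklore] `M1Of` commutes with scalars on the table: `M1Of (a • H) = a • M1Of H`. -/
theorem M1Of_smul (a : ℝ) : M1Of d Lc (a • H) cΛ j = a • M1Of d Lc H cΛ j := by
  funext μ w
  simp only [M1Of, Pi.smul_apply, smul_smul, mul_comm a]

/-- [folklore] `M1Of` of the zero table is zero. -/
theorem M1Of_zero : M1Of d Lc (0 : Fin (d + 1) → (Fin (d + 1) → ℤ) → MKer (d + 1) (Fib d)) cΛ j = 0 := by
  funext μ w
  simp only [M1Of, Pi.zero_apply, smul_zero]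

/-- [folklore] `M1Of` of a finite sum of tables is the sum (e.g. a symmetrisation `Σ_σ H^σ`). -/
theorem M1Of_sum {ι : Type*} (s : Finset ι) (Hs : ι → Fin (d + 1) → (Fin (d + 1) → ℤ) → MKer (d + 1) (Fib d)) :
    M1Of d Lc (∑ i ∈ s, Hs i) cΛ j = ∑ i ∈ s, M1Of d Lc (Hs i) cΛ j := by
  classical
  induction s using Finset.induction_on with
  | empty => rw [Finset.sum_empty, Finset.sum_empty, M1Of_zero]
  | insert i s hi ih => rw [Finset.sum_insert hi, Finset.sum_insert hi, M1Of_add, ih]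

/-- [folklore] At zero Lagrange coupling the multiplier table vanishes for every slot: `M1Of H 0 j = 0`. -/
theorem M1Of_coupling_zero : M1Of d Lc H 0 j = 0 := by
  funext μ w
  simp only [M1Of, zero_mul, zero_smul, Pi.zero_apply]

/-- [folklore] A vertex-family bound for a finite SUM of tables (the shape a symmetrised slot `Σ_σ H^σ` is fed to `vertexFamily_M1Of` in):
termwise `VertexFamily (Hs i) Lc (C i) δ` ⟹ `VertexFamily (Σ_{i ∈ s} Hs i) Lc (Σ_{i ∈ s} C i) δ`. -/
theorem vertexFamily_sum {ι : Type*} (s : Finset ι) {Hs : ι → Fin (d + 1) → (Fin (d + 1) → ℤ) → MKer (d + 1) (Fib d)} {C : ι → ℝ}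
    {δ : ℝ} (h : ∀ i ∈ s, VertexFamily (Hs i) Lc (C i) δ) : VertexFamily (∑ i ∈ s, Hs i) Lc (∑ i ∈ s, C i) δ := by
  intro μ w
  have e : (∑ i ∈ s, Hs i) μ w = fun x z a b => ∑ i ∈ s, Hs i μ w x z a b := by
    funext x z a b
    simp only [Finset.sum_apply]
  rw [e]
  exact biLoc_finset_sum s fun i hi => h i hi μ w

/-- [folklore] Block-translation covariance for a finite SUM of tables (the shape a symmetrised slot `Σ_σ H^σ` is fed to `M1Of_translate` in):
termwise covariance ⟹ covariance of the sum (`shiftK` is additive, entrywise). -/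
theorem translate_sum {ι : Type*} (s : Finset ι) {Hs : ι → Fin (d + 1) → (Fin (d + 1) → ℤ) → MKer (d + 1) (Fib d)}
    (h : ∀ i ∈ s, ∀ (μ : Fin (d + 1)) (w t : Fin (d + 1) → ℤ), Hs i μ (w + t) = shiftK (-((Lc : ℤ) • t)) (Hs i μ w))
    (μ : Fin (d + 1)) (w t : Fin (d + 1) → ℤ) :
    (∑ i ∈ s, Hs i) μ (w + t) = shiftK (-((Lc : ℤ) • t)) ((∑ i ∈ s, Hs i) μ w) := by
  funext x z a b
  simp only [Finset.sum_apply, shiftK]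
  exact Finset.sum_congr rfl fun i hi => by rw [h i hi μ w t]; rfl

end Linear

end Summit.QuantumFields.BalabanUV.Beta.SpineRooted

end
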